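/-
Copyright (c) 2026 the pub-hodgecm-mathlib formalisation cell (harness21).  Prover seat hodgecm-mathlib-K2E3-p12 (g8), Track B ∕ K2-LIT, h413 = `stmt-HodgeConjecture-24833`,
line `K2_E1_TraceFormulaBeta`, campaign «R8₂-sph EXHAUSTION», deal (69)∕(101) f3-sph + rulings (111)∕(122)∕(124) of the dealer K2E1-plan (g6): FILE D-FINAL = the LETTER-FREE HEAD
`pseudoEisenstein_inner_product_cm_two` — the INNER PRODUCT FORMULA for spherical pseudo-Eisenstein series on `U(1,1)_{L∕L⁺}` [MoeglinWaldspurger1995, II.2.1] in rank one, every input ★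
(the hypothesis-first twin on the letters `hweight`∕`hradial` is ★ p859654 `K2E1PseudoEisensteinInnerProductCMTwo.pseudoEisenstein_inner_product_cm_two_of_letters` of K2E1-p12 (g0); this file is
the direct assembly and imports neither letter).
-/
import Summits.HodgeConjecture.HodgeConjecture.Theorems.K2E1PseudoEisensteinRadialCMTwo    -- ★ D0 p859615 (this seat): the radial pseudo-Eisenstein toolkit (θ_f bounded, CT(θ_f) in Mellin form, X → weight-level unfolding); transitively ★ A, ★ B, (δ)₂, hAVG
import Summits.HodgeConjecture.HodgeConjecture.Theorems.K2E1IdeleClassRadialIntegralCM     -- ★ C p859507 (K2E1-p13): `∫_{𝓕_I} ‖x‖⁻¹•φ(‖x‖) dν_I = V•∫_0^∞ φ(r)r^{−2} dr` (+ ℝ≥0∞ twin)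
import HarnessLib

/-!
# R8₂-sph (69) f3-sph FILE D-FINAL — `K2E1PseudoEisensteinInnerProductCMTwoFinal`: THE INNER PRODUCT FORMULA FOR SPHERICAL PSEUDO-EISENSTEIN SERIES ON `U(1,1)_{L∕L⁺}` (MW II.2.1, rank one), LETTER-FREE
# `⟨θ_f, θ_{f′}⟩_X = C·(2π)⁻¹ ∫_ℝ f̃(z)·( conj f̃′(1 − z̄) + (ν𝓕)⁻¹·c(z)·conj f̃′(z̄) ) dy`, `z = σ₀ + iy`, `σ₀ > 1`, `C > 0` INDEPENDENT of `f, f′, σ₀`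

Track B ∕ K2-LIT, crux h413 = `stmt-HodgeConjecture-24833`, route of record `HCCMUnconditional`; cell `hodgecm-mathlib`, squad K2, ENGINE E1.  THEOREMS ONLY (no `def`, no `instance`,
no `notation`, no named-fact hypothesis, no `sorry`; default heartbeats); lane `--supports stmt-HodgeConjecture-24833 --as helper` (count-neutral).  Convention of record = LEFT
(`θ_f := eisensteinSeriesU (fun g => f (borelHeight g))`, `quotFun F [g] = F(g̃⁻¹)`, `borelConstantTerm ν 𝓕 φ g = (ν𝓕)⁻¹∫_𝓕 φ(ug) dν`); `f̃(z) := mellin f (−z)` (★ A's `H^z` convention);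
`c(z) := ∫_{N(𝔸)} H(w₀v)^z dν` spelled out as in ★ B.
THE MATHEMATICS ([MoeglinWaldspurger1995, II.1.2–II.1.8, II.2.1]; [Garrett2018, §1.8–§1.12, §2.8]; [CasselsFrohlichANT1967, Ch. XV §4.3]).  For `f, f′ ∈ C²_c((0,∞))` and `σ₀ > 1`:
(1) UNFOLDING `X → B(F)`-weight level against a covering weight `β` of `B(F)♯` (★ D0 `exists_integral_quotFun_eisensteinSeriesU_mul_conj_eq`; `θ_{f′}` is bounded ★ D0, Borel,
`G(F)`-invariant): `⟨θ_f, θ_{f′}⟩_X = c_μ ∫ β•((f∘H)·conj θ_{f′}) dν_G`; (2) THE AVERAGE IS FREE (★ hAVG `integral_wt_smul_mul_conj_eq_mul_conj_borelConstantTerm_two`): `θ_{f′} ↦ θ_{f′,B}`;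
(3) CONSTANT TERM (★ D0, = ★ R3 ∘ ★ B): `θ_{f′,B} = F′∘H`, `F′ := f′ + (ν𝓕)⁻¹·Mf′`, `(Mf′)(r) = (2π)⁻¹∫ f̃′(w)c(w)r^{1−w} dy′` (continuous on `(0,∞)`, §1); (4) TO THE IDELE CLASSES
(★ (δ)₂ `exists_integral_weight_smul_eq_mul_setIntegral_ideleClass_two`, `K_U`-average of a function of `H` = `m_K` times it, `H(tk) = ‖d₀t‖`): `= c_μ·K·∫_{𝓕_I} ‖x‖⁻¹•(m_K·f(‖x‖)conj F′(‖x‖)) dν_I`;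
(5) TATE's `d𝔞 = d𝔟 dt∕t` (★ C): `= c_μ·K·V·m_K·∫_0^∞ f(r)·conj F′(r)·r^{−2} dr`; (6) MELLIN–PARSEVAL (★ A I + II, `conj c(z̄) = c(z)` §1):
**`⟨θ_f, θ_{f′}⟩_X = C·(2π)⁻¹∫_ℝ f̃(z)·(conj(mellin f′ (z̄ − 1)) + (ν𝓕)⁻¹·c(z)·conj(mellin f′ (−z̄))) dy`**, `C = c_μ·K·V·m_K > 0` — MW II.2.1 `⟨θ_φ, θ_ψ⟩ = ∫_{Re π = π₀} Σ_w (M(w,π)φ(π), ψ(−w π̄)) dπ`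
for `G = U(1,1)`, `W = {1, w₀}`, `M(1, z) = 1`, `M(w₀, z) = (ν𝓕)⁻¹c(z)`, `−π̄ ↔ 1 − z̄`, `−w₀π̄ ↔ z̄` in the `H^z` normalisation (`ρ = 1∕2` absorbed).
* §1 pure analysis: `continuous_and_integrable_norm_mellin_neg`, `integral_ofReal_cpow_conj` (`c(z̄) = conj c(z)`), `continuousOn_mellinIntertwined` (dominated convergence),
  `setLIntegral_inv_mul_inv_mul_enorm_lt_top` (content-adjacent to ★ p859654 §1–§2 `continuousAt_integral_mellin_mul_cpow`, `conj_integral_ofReal_cpow_conj`, stated in the shapes this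
  assembly consumes).  * §2 the CM pair: **`pseudoEisenstein_inner_product_cm_two`** (HEAD OF RECORD, bytes of the dealer's ruling (111): binders = the (R7-sph)₂ closer's + MS-TWO's
  `μK νI h𝓕I`; `∃ C > 0` BEFORE `∀ f f′ σ₀`; `conj (mellin f′ (conj z − 1))` for `conj f̃′(1 − z̄)`).
HONEST LABEL: HC_CM is proved only modulo the 7 printed citations (2 remaining named inputs: hLiu418 = `stmt-HodgeConjecture-24832`, h413 = `stmt-HodgeConjecture-24833`) until rung 0
closes; this file asserts no named fact, closes no socket; count-neutral; letter-free (structural measure data `μ, ν_G, μ_K, ν_I, 𝓕_I, ν, 𝓕` only).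

## References
* [MoeglinWaldspurger1995] C. Mœglin, J.-L. Waldspurger, *Spectral decomposition and Eisenstein series* (1995), II.1.2–II.1.8, II.2.1.
* [Garrett2018] P. Garrett, *Modern Analysis of Automorphic Forms by Example* (2018), §1.8–§1.12, §2.8.
* [CasselsFrohlichANT1967] J. W. S. Cassels, A. Fröhlich (eds.), *Algebraic Number Theory* (1967), Ch. XV (Tate), §4.3–4.4.
* [Titchmarsh1948] E. C. Titchmarsh, *Introduction to the Theory of Fourier Integrals* (1948), §1.29, Thm 71–72.
-/

set_option autoImplicit false
set_option linter.dupNamespace false  -- the mandated namespace repeats the summit's segment (`HodgeConjecture.HodgeConjecture`)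

noncomputable section

open MeasureTheory Measure Set Filter Topology Complex NumberField IsDedekindDomain MulAction
open scoped Real NNReal ENNReal ComplexConjugate Pointwise
open Literature.MeasureTheory.Group Literature.NumberTheory
open Literature.NumberTheory.Automorphic Literature.NumberTheory.Automorphic.UnitaryGroup AdelicGroupData
open Summit.HodgeConjecture.HodgeConjecture.Cruxes.H413.K2E1BorelEisensteinU
open Summit.HodgeConjecture.HodgeConjecture.Cruxes.H413.K2E1MellinPaleyWienerHalfLine
open Summit.HodgeConjecture.HodgeConjecture.Cruxes.H413.K2E1SphericalIntertwiningMellinCMTwo (continuous_intertwiningScalar_vertical_cm_two norm_intertwiningScalar_vertical_le_cm_two)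
open Summit.HodgeConjecture.HodgeConjecture.Cruxes.H413.K2E1IdeleClassRadialIntegralCM (setIntegral_inv_ideleNorm_smul_comp_eq setLIntegral_inv_ideleNorm_mul_comp_eq)
open Summit.HodgeConjecture.HodgeConjecture.Cruxes.H413.K2E1PseudoEisensteinRadialCMTwo
open Summit.HodgeConjecture.HodgeConjecture.Cruxes.H413.K2E1EisensteinPairingUnfoldedWeightU2 (exists_integral_weight_smul_eq_mul_setIntegral_ideleClass_two)
open Summit.HodgeConjecture.HodgeConjecture.Cruxes.H413.K2E1BorelWeightAverage (integral_wt_smul_mul_conj_eq_mul_conj_borelConstantTerm_two)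
open Summit.HodgeConjecture.HodgeConjecture.Cruxes.H413.K2E1BorelParabolicIntegralU2 (borelHeight_coe_eq_ideleNorm_diagUnit)
open Summit.HodgeConjecture.HodgeConjecture.Cruxes.H413.K2E1MaassSelbergSphericalBracketsCMTwo (integral_maximalCompact_const measureReal_maximalCompact_pos)
open Summit.HodgeConjecture.HodgeConjecture.Cruxes.H413.K2E1UnipotentHaarNormalisationU2 (isInvInvariant_of_isHaarMeasure_two)

namespace Summit.HodgeConjecture.HodgeConjecture.Cruxes.H413.K2E1PseudoEisensteinInnerProductCMTwoFinal

/-! ## §1 Pure analysis: the Mellin-intertwined kernel is continuous on `(0,∞)`; `c(z̄) = conj c(z)`; a real-line finiteness; vertical integrability of the Parseval integrands -/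

section Analysis

variable {f g : ℝ → ℂ}

/-- The transform on the line `Re = σ₀` in the `H^z` convention, `y ↦ mellin g (−(σ₀+iy))`, is continuous and absolutely integrable for `g ∈ C²_c((0,∞))` (★ A). [cite: Titchmarsh1948, §1.29] -/
theorem continuous_and_integrable_norm_mellin_neg (hg : ContDiff ℝ 2 g) (hgs : HasCompactSupport g) (hg0 : tsupport g ⊆ Ioi 0) (σ₀ : ℝ) :
    Continuous (fun y : ℝ => mellin g (-((σ₀ : ℂ) + y * I))) ∧ Integrable fun y : ℝ => ‖mellin g (-((σ₀ : ℂ) + y * I))‖ := by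
  refine ⟨(differentiable_mellin hg.continuous hgs hg0).continuous.comp (by fun_prop), ?_⟩
  have h := (verticalIntegrable_mellin hg hgs hg0 (-σ₀)).comp_neg
  refine (h.congr (Eventually.of_forall fun y => ?_)).norm
  simp only [ofReal_neg]; congr 1; ring

/-- **`c(z̄) = conj c(z)`**: for a nonnegative real function `h`, `∫ h^{conj w} dν = conj ∫ h^w dν` (`(h:ℂ)^{conj w} = conj((h:ℂ)^w)` for `h ≥ 0`, Mathlib `cpow_conj`, `integral_conj`). [folklore] -/
theorem integral_ofReal_cpow_conj {α : Type*} [MeasurableSpace α] (ν : Measure α) {h : α → ℝ} (hh : ∀ a, 0 ≤ h a) (w : ℂ) :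
    ∫ a, ((h a : ℝ) : ℂ) ^ conj w ∂ν = conj (∫ a, ((h a : ℝ) : ℂ) ^ w ∂ν) := by
  rw [← integral_conj]
  refine integral_congr_ae (ae_of_all _ fun a => ?_)
  have harg : (((h a : ℝ) : ℂ)).arg ≠ π := by rw [arg_ofReal_of_nonneg (hh a)]; exact Real.pi_pos.ne
  dsimp only
  rw [cpow_conj _ _ harg, conj_ofReal]

/-- **THE MELLIN-INTERTWINED KERNEL IS CONTINUOUS ON `(0,∞)`**: for `g ∈ C²_c((0,∞))`, `σ₀ > 1` and `c` continuous and bounded on the line `Re = σ₀`,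
`r ↦ (2π)⁻¹ ∫_ℝ g̃(σ₀+iy)·c(σ₀+iy)·r^{1−(σ₀+iy)} dy` is continuous at every `r₀ > 0` — dominated convergence (Mathlib `continuousAt_of_dominated`) with the majorant
`(r₀∕2)^{1−σ₀}·C₀·‖g̃(σ₀+iy)‖` on `{r > r₀∕2}` (`r^{1−σ₀}` is antitone). [cite: MoeglinWaldspurger1995, II.1.4] [cite: Titchmarsh1948, Thm 71–72] -/
theorem continuousOn_mellinIntertwined (hg : ContDiff ℝ 2 g) (hgs : HasCompactSupport g) (hg0 : tsupport g ⊆ Ioi 0) {σ₀ : ℝ} (hσ₀ : 1 < σ₀)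
    {c : ℂ → ℂ} (hcc : Continuous fun y : ℝ => c ((σ₀ : ℂ) + y * I)) {C₀ : ℝ} (hcb : ∀ y : ℝ, ‖c ((σ₀ : ℂ) + y * I)‖ ≤ C₀) :
    ContinuousOn (fun r : ℝ => (((2 * π)⁻¹ : ℝ) : ℂ) * ∫ y : ℝ, mellin g (-((σ₀ : ℂ) + y * I)) * c ((σ₀ : ℂ) + y * I) * (r : ℂ) ^ (1 - ((σ₀ : ℂ) + y * I))) (Ioi 0) := by
  obtain ⟨hGc, hGi⟩ := continuous_and_integrable_norm_mellin_neg hg hgs hg0 σ₀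
  have hC₀ : 0 ≤ C₀ := (norm_nonneg _).trans (hcb 0)
  refine continuousOn_const.mul ((isOpen_Ioi.continuousOn_iff).2 ?_)
  intro r₀ hr₀
  have hr₀' : (0 : ℝ) < r₀ := hr₀
  have hev : ∀ᶠ r : ℝ in 𝓝 r₀, r₀ / 2 < r := lt_mem_nhds (by linarith)
  refine continuousAt_of_dominated (bound := fun y => (r₀ / 2) ^ (1 - σ₀) * C₀ * ‖mellin g (-((σ₀ : ℂ) + y * I))‖) ?_ ?_ (hGi.const_mul _) ?_
  · filter_upwards [hev] with r hr
    have hr0 : (0 : ℝ) < r := by linarith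
    exact ((hGc.mul hcc).mul (continuous_const.cpow (by fun_prop) fun _ => ofReal_mem_slitPlane.2 hr0)).aestronglyMeasurable
  · filter_upwards [hev] with r hr
    refine Eventually.of_forall fun y => ?_
    have hr0 : (0 : ℝ) < r := by linarith
    have hre : (1 - ((σ₀ : ℂ) + y * I)).re = 1 - σ₀ := by simp
    rw [norm_mul, norm_mul, norm_cpow_eq_rpow_re_of_pos hr0, hre]
    have h1 : r ^ (1 - σ₀) ≤ (r₀ / 2) ^ (1 - σ₀) := Real.rpow_le_rpow_of_nonpos (by linarith) hr.le (by linarith)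
    calc ‖mellin g (-((σ₀ : ℂ) + y * I))‖ * ‖c ((σ₀ : ℂ) + y * I)‖ * r ^ (1 - σ₀)
        ≤ ‖mellin g (-((σ₀ : ℂ) + y * I))‖ * C₀ * (r₀ / 2) ^ (1 - σ₀) :=
          mul_le_mul (mul_le_mul_of_nonneg_left (hcb y) (norm_nonneg _)) h1 (Real.rpow_nonneg hr0.le _) (mul_nonneg (norm_nonneg _) hC₀)
      _ = (r₀ / 2) ^ (1 - σ₀) * C₀ * ‖mellin g (-((σ₀ : ℂ) + y * I))‖ := by ring
  · refine Eventually.of_forall fun y => ?_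
    exact (continuousAt_const.mul (continuousAt_ofReal_cpow_const r₀ _ (Or.inr hr₀'.ne')))

/-- **A REAL-LINE FINITENESS**: for `f ∈ C_c((0,∞))` (so `f = 0` off some `(T⁻¹, T)`) and a finite constant `C`, `∫⁻_0^∞ r⁻¹·r⁻¹·(‖f r‖·C) dr < ∞` — the `[0,∞]` clauses of ★ (δ)₂ after ★ C's
radial push-forward (`r⁻² ≤ T²` where `f ≠ 0`, `f ∈ L¹`). [folklore] -/
theorem setLIntegral_inv_mul_inv_mul_enorm_lt_top (hfc : Continuous f) (hfs : HasCompactSupport f) (hf0 : tsupport f ⊆ Ioi 0) {C : ℝ≥0∞} (hC : C ≠ ∞) :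
    ∫⁻ r in Ioi (0 : ℝ), ENNReal.ofReal (r⁻¹ * r⁻¹) * (‖f r‖ₑ * C) < ∞ := by
  obtain ⟨T, hT, -, hlo⟩ := exists_one_le_forall_eq_zero hfs hf0
  have hT0 : (0 : ℝ) < T := by exact_mod_cast one_pos.trans_le hT
  have hpt : ∀ r : ℝ, ENNReal.ofReal (r⁻¹ * r⁻¹) * (‖f r‖ₑ * C) ≤ ENNReal.ofReal ((T : ℝ) * T) * C * ‖f r‖ₑ := by
    intro r
    by_cases hr : f r = 0
    · simp [hr]
    · have hTr : (T : ℝ)⁻¹ ≤ r := not_lt.1 fun h => hr (hlo r h)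
      have hr0 : 0 < r := (inv_pos.2 hT0).trans_le hTr
      have h1 : r⁻¹ ≤ T := by rw [inv_le_comm₀ hr0 hT0]; exact hTr
      have h2 : r⁻¹ * r⁻¹ ≤ (T : ℝ) * T := mul_le_mul h1 h1 (inv_nonneg.2 hr0.le) hT0.le
      calc ENNReal.ofReal (r⁻¹ * r⁻¹) * (‖f r‖ₑ * C) ≤ ENNReal.ofReal ((T : ℝ) * T) * (‖f r‖ₑ * C) := by gcongr
        _ = ENNReal.ofReal ((T : ℝ) * T) * C * ‖f r‖ₑ := by ring
  have hfi : ∫⁻ r, ‖f r‖ₑ ∂(volume : Measure ℝ) < ∞ := (hfc.integrable_of_hasCompactSupport hfs).2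
  calc ∫⁻ r in Ioi (0 : ℝ), ENNReal.ofReal (r⁻¹ * r⁻¹) * (‖f r‖ₑ * C)
      ≤ ∫⁻ r in Ioi (0 : ℝ), ENNReal.ofReal ((T : ℝ) * T) * C * ‖f r‖ₑ := lintegral_mono fun r => hpt r
    _ ≤ ∫⁻ r, ENNReal.ofReal ((T : ℝ) * T) * C * ‖f r‖ₑ ∂(volume : Measure ℝ) := lintegral_mono' Measure.restrict_le_self le_rfl
    _ = ENNReal.ofReal ((T : ℝ) * T) * C * ∫⁻ r, ‖f r‖ₑ ∂(volume : Measure ℝ) := lintegral_const_mul' _ _ (ENNReal.mul_ne_top ENNReal.ofReal_ne_top hC)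
    _ < ∞ := ENNReal.mul_lt_top (ENNReal.mul_lt_top ENNReal.ofReal_lt_top hC.lt_top) hfi

end Analysis

/-! ## §2 The HEAD: the inner product formula for spherical pseudo-Eisenstein series of `U(1,1)_{L∕L⁺}` -/

section Head

variable (L : Type) [Field L] [NumberField L] [IsCMField L]
variable [MeasurableSpace (quasiSplit (↥(maximalRealSubfield L)) L (IsCMField.complexConj L) 2).Adelic] [BorelSpace (quasiSplit (↥(maximalRealSubfield L)) L (IsCMField.complexConj L) 2).Adelic]
variable [MeasurableSpace (AdeleRing (𝓞 L) L)ˣ] [BorelSpace (AdeleRing (𝓞 L) L)ˣ]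

/-- **THE INNER PRODUCT FORMULA FOR SPHERICAL PSEUDO-EISENSTEIN SERIES ON `U(1,1)_{L∕L⁺}` (MW II.2.1 in rank one).**  Data: an automorphic measure `μ` on `X = G(𝔸)∕G(L⁺)`, Haar
measures `ν_G` (inversion-invariant) on `G(𝔸)`, `μ_K` on `K_U`, `ν_I` on `𝕀_L` with an idele class domain `𝓕_I`, `ν` on `N(𝔸)` with a fundamental domain `𝓕` of `N(L⁺)` of compact closure
and `ν𝓕 ≠ 0`.  THEN there is ONE constant `C > 0` (`= c_μ·K·V·m_K`: Weil's unfolding constant × the (δ)₂ constant × the idelic covolume × `μ_K(K_U)` — independent of `f, f′, σ₀`) such that for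
all `f, f′ ∈ C²_c((0,∞))` and every `σ₀ > 1`, with `θ_f = E(f∘H)`, `z = σ₀ + iy`, `f̃(z) = mellin f (−z)`, `c(z) = ∫_{N(𝔸)} H(w₀v)^z dν`: the pairing `x ↦ θ_f(x̃⁻¹)·conj θ_{f′}(x̃⁻¹)` is
`μ`-integrable and **`∫_X θ_f·conj θ_{f′} dμ = C·(2π)⁻¹·∫_ℝ f̃(z)·( conj (mellin f′ (z̄ − 1)) + (ν𝓕)⁻¹·c(z)·conj (mellin f′ (−z̄)) ) dy`** — i.e. `C·(2πi)⁻¹∫_{Re z = σ₀} f̃(z)(conj f̃′(1−z̄) +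
(ν𝓕)⁻¹c(z)·conj f̃′(z̄)) dz`, the `w = 1` and `w = w₀` terms of [MW, II.2.1].  Assembly: ★ D0 unfolding (θ_{f′} bounded) → ★ hAVG → ★ D0 constant term (★ R3 ∘ ★ B) → ★ (δ)₂ → ★ C → ★ A
Parseval I + II (`conj c(z̄) = c(z)`). [cite: MoeglinWaldspurger1995, II.2.1] [cite: Garrett2018, §1.10–§1.12] [cite: CasselsFrohlichANT1967, Ch. XV §4.3] -/
theorem pseudoEisenstein_inner_product_cm_two
    (μ : Measure (quasiSplit (↥(maximalRealSubfield L)) L (IsCMField.complexConj L) 2).automorphicQuotient) [(quasiSplit (↥(maximalRealSubfield L)) L (IsCMField.complexConj L) 2).IsAutomorphicMeasure μ]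
    (νG : Measure (quasiSplit (↥(maximalRealSubfield L)) L (IsCMField.complexConj L) 2).Adelic) [νG.IsHaarMeasure] [νG.IsInvInvariant]
    (μK : Measure ((standardMaximalCompactGL 2 L).comap (adelicVal (↥(maximalRealSubfield L)) L (IsCMField.complexConj L) 2 ((StdForm.antidiagonal 2).over L)) : Subgroup (quasiSplit (↥(maximalRealSubfield L)) L (IsCMField.complexConj L) 2).Adelic))
    [μK.IsHaarMeasure]
    (νI : Measure (AdeleRing (𝓞 L) L)ˣ) [νI.IsHaarMeasure]
    {𝓕I : Set (AdeleRing (𝓞 L) L)ˣ} (h𝓕I : IsIdeleClassDomain L 𝓕I)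
    (ν : Measure ↥(adelicUnipotent (↥(maximalRealSubfield L)) L (IsCMField.complexConj L) 2)) [ν.IsHaarMeasure]
    {𝓕 : Set ↥(adelicUnipotent (↥(maximalRealSubfield L)) L (IsCMField.complexConj L) 2)}
    (h𝓕N : IsFundamentalDomain ↥(rationalUnipotent (↥(maximalRealSubfield L)) L (IsCMField.complexConj L) 2) 𝓕 ν) (h𝓕c : IsCompact (closure 𝓕)) (h𝓕₀ : ν 𝓕 ≠ 0) :
    ∃ C : ℝ, 0 < C ∧
      ∀ {f f' : ℝ → ℂ}, ContDiff ℝ 2 f → HasCompactSupport f → tsupport f ⊆ Ioi 0 → ContDiff ℝ 2 f' → HasCompactSupport f' → tsupport f' ⊆ Ioi 0 →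
      ∀ {σ₀ : ℝ}, 1 < σ₀ →
        Integrable (fun x : (quasiSplit (↥(maximalRealSubfield L)) L (IsCMField.complexConj L) 2).automorphicQuotient =>
            (quasiSplit (↥(maximalRealSubfield L)) L (IsCMField.complexConj L) 2).quotFun (eisensteinSeriesU (fun g : (quasiSplit (↥(maximalRealSubfield L)) L (IsCMField.complexConj L) 2).Adelic => f (borelHeight g : ℝ))) x *
              conj ((quasiSplit (↥(maximalRealSubfield L)) L (IsCMField.complexConj L) 2).quotFun (eisensteinSeriesU (fun g : (quasiSplit (↥(maximalRealSubfield L)) L (IsCMField.complexConj L) 2).Adelic => f' (borelHeight g : ℝ))) x)) μ ∧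
        ∫ x, (quasiSplit (↥(maximalRealSubfield L)) L (IsCMField.complexConj L) 2).quotFun (eisensteinSeriesU (fun g : (quasiSplit (↥(maximalRealSubfield L)) L (IsCMField.complexConj L) 2).Adelic => f (borelHeight g : ℝ))) x *
            conj ((quasiSplit (↥(maximalRealSubfield L)) L (IsCMField.complexConj L) 2).quotFun (eisensteinSeriesU (fun g : (quasiSplit (↥(maximalRealSubfield L)) L (IsCMField.complexConj L) 2).Adelic => f' (borelHeight g : ℝ))) x) ∂μ =
          (C : ℂ) * ((((2 * π)⁻¹ : ℝ) : ℂ) * ∫ y : ℝ, mellin f (-((σ₀ : ℂ) + y * I)) *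
            (conj (mellin f' (conj ((σ₀ : ℂ) + y * I) - 1)) +
              (((ν 𝓕).toReal⁻¹ : ℝ) : ℂ) * (∫ v : ↥(adelicUnipotent (↥(maximalRealSubfield L)) L (IsCMField.complexConj L) 2), (((borelHeight ((quasiSplit (↥(maximalRealSubfield L)) L (IsCMField.complexConj L) 2).toAdelic (weylLongU ((IsCMField.complexConj L : L ≃ₐ[↥(maximalRealSubfield L)] L) : L →+* L) (rfl : (StdForm.antidiagonal 2).over L = (StdForm.antidiagonal 2).over L)) * (v : (quasiSplit (↥(maximalRealSubfield L)) L (IsCMField.complexConj L) 2).Adelic))) : ℝ) : ℂ) ^ (((σ₀ : ℂ) + y * I)) ∂ν) *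
                conj (mellin f' (-conj ((σ₀ : ℂ) + y * I))))) := by
  classical
  -- (0) structure on `G(𝔸)`, constants
  haveI := t2Space_adeleRing_of_numberField L
  haveI := locallyCompactSpace_adeleRing' L
  haveI := secondCountableTopology_adeleRing L
  haveI : SecondCountableTopology (quasiSplit (↥(maximalRealSubfield L)) L (IsCMField.complexConj L) 2).Adelic :=
    inferInstanceAs (SecondCountableTopology (adelic (↥(maximalRealSubfield L)) L (IsCMField.complexConj L) 2 ((StdForm.antidiagonal 2).over L)))
  haveI : ν.IsInvInvariant := isInvInvariant_of_isHaarMeasure_two ν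
  have h𝓕top : ν 𝓕 ≠ ∞ := ((measure_mono subset_closure).trans_lt h𝓕c.measure_lt_top).ne
  have hc : IsCMField.complexConj L * IsCMField.complexConj L = 1 := AlgEquiv.ext fun x => IsCMField.complexConj_apply_apply L x
  have hc1 : IsCMField.complexConj L ≠ 1 := IsCMField.complexConj_ne_one L
  have hBK := exists_mem_borelAdelic_mul_mem_standardMaximalCompactGL_cm L (N := 2)
  have hKc : IsCompact (((standardMaximalCompactGL 2 L).comap (adelicVal (↥(maximalRealSubfield L)) L (IsCMField.complexConj L) 2 ((StdForm.antidiagonal 2).over L)) :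
      Subgroup (quasiSplit (↥(maximalRealSubfield L)) L (IsCMField.complexConj L) 2).Adelic) : Set (quasiSplit (↥(maximalRealSubfield L)) L (IsCMField.complexConj L) 2).Adelic) :=
    isCompact_comap_adelicVal_standardMaximalCompactGL
  haveI : CompactSpace ((standardMaximalCompactGL 2 L).comap (adelicVal (↥(maximalRealSubfield L)) L (IsCMField.complexConj L) 2 ((StdForm.antidiagonal 2).over L)) :
      Subgroup (quasiSplit (↥(maximalRealSubfield L)) L (IsCMField.complexConj L) 2).Adelic) := isCompact_iff_compactSpace.1 hKc
  haveI : IsFiniteMeasure μK := CompactSpace.isFiniteMeasure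
  -- a covering weight of `B(F)♯` (discrete inside `G(F)`)
  haveI : DiscreteTopology (quasiSplit (↥(maximalRealSubfield L)) L (IsCMField.complexConj L) 2).arithmeticSubgroup := isDiscreteRational_quasiSplit
  haveI : DiscreteTopology ↥((arithmeticBorel (↥(maximalRealSubfield L)) L (IsCMField.complexConj L) 2).map (quasiSplit (↥(maximalRealSubfield L)) L (IsCMField.complexConj L) 2).arithmeticSubgroup.subtype) :=
    DiscreteTopology.of_subset ‹DiscreteTopology (quasiSplit (↥(maximalRealSubfield L)) L (IsCMField.complexConj L) 2).arithmeticSubgroup› (Subgroup.map_subtype_le _)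
  obtain ⟨β, hβ⟩ := exists_isCoveringWeight ((arithmeticBorel (↥(maximalRealSubfield L)) L (IsCMField.complexConj L) 2).map (quasiSplit (↥(maximalRealSubfield L)) L (IsCMField.complexConj L) 2).arithmeticSubgroup.subtype)
  obtain ⟨cμ, hcμ, hunf⟩ := exists_integral_quotFun_eisensteinSeriesU_mul_conj_eq (F := ↥(maximalRealSubfield L)) (E := L) (c := IsCMField.complexConj L) (N := 2) μ νG
  obtain ⟨K, hK0, hKt, hδ0, hδ⟩ := exists_integral_weight_smul_eq_mul_setIntegral_ideleClass_two hc hc1 νG μK νI hBK h𝓕I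
  have hm : 0 < μK.real Set.univ := measureReal_maximalCompact_pos μK
  have hV0 : idelicCovolume L νI ≠ 0 := idelicCovolume_ne_zero νI
  have hVt : idelicCovolume L νI ≠ ∞ := idelicCovolume_ne_top νI
  refine ⟨cμ * (K.toReal * ((idelicCovolume L νI).toReal * μK.real Set.univ)),
    mul_pos hcμ (mul_pos (ENNReal.toReal_pos hK0 hKt) (mul_pos (ENNReal.toReal_pos hV0 hVt) hm)), ?_⟩
  intro f f' hf hfs hf0 hf' hf's hf'0 σ₀ hσ₀
  -- the torus∕idele dictionary `H(t k) = ‖d₀ t‖`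
  have hHtk : ∀ (t : torusInBorel (↥(maximalRealSubfield L)) L (IsCMField.complexConj L) 2) (k : ((standardMaximalCompactGL 2 L).comap (adelicVal (↥(maximalRealSubfield L)) L (IsCMField.complexConj L) 2 ((StdForm.antidiagonal 2).over L)) :
      Subgroup (quasiSplit (↥(maximalRealSubfield L)) L (IsCMField.complexConj L) 2).Adelic)),
      borelHeight (((t : borelAdelic (↥(maximalRealSubfield L)) L (IsCMField.complexConj L) 2) : (quasiSplit (↥(maximalRealSubfield L)) L (IsCMField.complexConj L) 2).Adelic) * (k : (quasiSplit (↥(maximalRealSubfield L)) L (IsCMField.complexConj L) 2).Adelic)) =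
        IdeleClassGroup.ideleNorm L (diagUnit (t : borelAdelic (↥(maximalRealSubfield L)) L (IsCMField.complexConj L) 2).2 0) := fun t k => by
    rw [borelHeight_mul_of_mem_comap_standardMaximalCompactGL k.2, borelHeight_coe_eq_ideleNorm_diagUnit]
  have hIm : Measurable fun x : (AdeleRing (𝓞 L) L)ˣ => IdeleClassGroup.ideleNorm L x := (continuous_ideleNorm_holds L).measurable
  have hIc : Continuous fun x : (AdeleRing (𝓞 L) L)ˣ => (IdeleClassGroup.ideleNorm L x : ℝ) := NNReal.continuous_coe.comp (continuous_ideleNorm_holds L)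
  have hHc : Continuous fun g : (quasiSplit (↥(maximalRealSubfield L)) L (IsCMField.complexConj L) 2).Adelic => (borelHeight g : ℝ) := NNReal.continuous_coe.comp continuous_borelHeight
  -- names: `c(z)`, `(ν𝓕)⁻¹`, `Mf′`, `F′ = θ_{f′,B}` as a function of `H`, `φ₀ = f·conj F′`, `θ′ = θ_{f′}`
  set cfun : ℂ → ℂ := fun w => ∫ v : ↥(adelicUnipotent (↥(maximalRealSubfield L)) L (IsCMField.complexConj L) 2), (((borelHeight ((quasiSplit (↥(maximalRealSubfield L)) L (IsCMField.complexConj L) 2).toAdelic (weylLongU ((IsCMField.complexConj L : L ≃ₐ[↥(maximalRealSubfield L)] L) : L →+* L) (rfl : (StdForm.antidiagonal 2).over L = (StdForm.antidiagonal 2).over L)) * (v : (quasiSplit (↥(maximalRealSubfield L)) L (IsCMField.complexConj L) 2).Adelic))) : ℝ) : ℂ) ^ w ∂ν with hcfun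
  set κN : ℝ := (ν 𝓕).toReal⁻¹ with hκN
  set Mf' : ℝ → ℂ := fun r => (((2 * π)⁻¹ : ℝ) : ℂ) * ∫ y : ℝ, mellin f' (-((σ₀ : ℂ) + y * I)) * cfun ((σ₀ : ℂ) + y * I) * (r : ℂ) ^ (1 - ((σ₀ : ℂ) + y * I)) with hMf'
  set F' : ℝ → ℂ := fun r => f' r + (κN : ℂ) * Mf' r with hF'
  set φ₀ : ℝ → ℂ := fun r => f r * conj (F' r) with hφ₀
  set θ' : (quasiSplit (↥(maximalRealSubfield L)) L (IsCMField.complexConj L) 2).Adelic → ℂ := eisensteinSeriesU (fun g : (quasiSplit (↥(maximalRealSubfield L)) L (IsCMField.complexConj L) 2).Adelic => f' (borelHeight g : ℝ)) with hθ'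
  -- (1) the scalar `c` on the line `Re = σ₀`: continuous, bounded, `conj c(z̄) = c(z)`
  have hcc : Continuous fun y : ℝ => cfun ((σ₀ : ℂ) + y * I) := continuous_intertwiningScalar_vertical_cm_two L ν h𝓕N h𝓕c hσ₀
  obtain ⟨C₀, hcb⟩ : ∃ C₀ : ℝ, ∀ y : ℝ, ‖cfun ((σ₀ : ℂ) + y * I)‖ ≤ C₀ := ⟨_, fun y => norm_intertwiningScalar_vertical_le_cm_two L ν σ₀ y⟩
  have hsym : ∀ w : ℂ, cfun (conj w) = conj (cfun w) := fun w =>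
    integral_ofReal_cpow_conj ν (h := fun v : ↥(adelicUnipotent (↥(maximalRealSubfield L)) L (IsCMField.complexConj L) 2) => (borelHeight ((quasiSplit (↥(maximalRealSubfield L)) L (IsCMField.complexConj L) 2).toAdelic (weylLongU ((IsCMField.complexConj L : L ≃ₐ[↥(maximalRealSubfield L)] L) : L →+* L) (rfl : (StdForm.antidiagonal 2).over L = (StdForm.antidiagonal 2).over L)) * (v : (quasiSplit (↥(maximalRealSubfield L)) L (IsCMField.complexConj L) 2).Adelic)) : ℝ))
      (fun v => NNReal.coe_nonneg _) w
  -- (2) regularity of `Mf′`, `F′`, `φ₀` on `(0,∞)`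
  have hMc : ContinuousOn Mf' (Ioi 0) := continuousOn_mellinIntertwined hf' hf's hf'0 hσ₀ hcc hcb
  have hF'c : ContinuousOn F' (Ioi 0) := hf'.continuous.continuousOn.add (continuousOn_const.mul hMc)
  have hφ₀c : ContinuousOn φ₀ (Ioi 0) := hf.continuous.continuousOn.mul (continuous_conj.comp_continuousOn hF'c)
  obtain ⟨B, hB⟩ := hfs.isCompact.exists_bound_of_continuousOn (hF'c.mono hf0)
  have hφ₀le : ∀ r : ℝ, ‖φ₀ r‖ₑ ≤ ‖f r‖ₑ * ENNReal.ofReal (max B 0) := by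
    intro r
    by_cases hr : f r = 0
    · simp [hφ₀, hr]
    · have hmem : r ∈ tsupport f := subset_tsupport f (Function.mem_support.2 hr)
      rw [hφ₀]
      dsimp only
      rw [enorm_mul, ← ofReal_norm (conj (F' r)), Complex.norm_conj]
      gcongr
      exact (hB r hmem).trans (le_max_left _ _)
  -- (3) `θ′` is Borel, `G(L⁺)`-invariant and bounded; the `L¹` letter `∫⁻ β‖f∘H‖ < ∞` via ★ (δ)₂ `[0,∞]` + ★ C
  obtain ⟨M₁, hM₁⟩ := exists_bound_eisensteinSeriesU_comp_borelHeight_cm_two L hf'.continuous hf's hf'0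
  have hθ'm : Measurable θ' := measurable_eisensteinSeriesU_comp_borelHeight_cm_two L hf'.continuous hf's hf'0
  have hθ'G : ∀ (γ : (quasiSplit (↥(maximalRealSubfield L)) L (IsCMField.complexConj L) 2).arithmeticSubgroup) (x : (quasiSplit (↥(maximalRealSubfield L)) L (IsCMField.complexConj L) 2).Adelic),
      θ' ((γ : (quasiSplit (↥(maximalRealSubfield L)) L (IsCMField.complexConj L) 2).Adelic) * x) = θ' x := eisensteinSeriesU_comp_borelHeight_arithmeticSubgroup_mul f'
  have hfm : Measurable fun g : (quasiSplit (↥(maximalRealSubfield L)) L (IsCMField.complexConj L) 2).Adelic => f (borelHeight g : ℝ) := (hf.continuous.comp hHc).measurable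
  have hL1 : ∫⁻ g, β g * ‖f (borelHeight g : ℝ)‖ₑ ∂νG < ∞ := by
    have hL := hδ0 β hβ (fun g => ‖f (borelHeight g : ℝ)‖ₑ) hfm.enorm
      (fun n y => by simp only [borelHeight_unipotent_mul ((mem_unipotentInBorel_iff _).1 n.2)])
      (fun b hb y => by simp only [K2E1TruncatedEisensteinExplicit.borelHeight_arithmeticBorel_mul hb])
      (fun x => ‖f (IdeleClassGroup.ideleNorm L x : ℝ)‖ₑ * μK Set.univ) ((hf.continuous.comp hIc).measurable.enorm.mul_const _)
      (fun k hk x => by simp only [map_mul, ideleNorm_principal hk, one_mul]) (fun t => by simp_rw [hHtk t]; exact lintegral_const _)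
    rw [hL, setLIntegral_inv_ideleNorm_mul_comp_eq νI h𝓕I (Gm := fun r => ‖f r‖ₑ * μK Set.univ) (hf.continuous.measurable.enorm.mul_const _)]
    exact ENNReal.mul_lt_top hKt.lt_top (ENNReal.mul_lt_top hVt.lt_top (setLIntegral_inv_mul_inv_mul_enorm_lt_top hf.continuous hfs hf0 (measure_ne_top μK _)))
  -- (4) unfolding `X → B(F)`-weight level, then the average is free
  obtain ⟨hInt, hEq⟩ := hunf hβ (f := fun g => f (borelHeight g : ℝ)) (Λ' := θ') hfm (comp_borelHeight_arithmeticBorel_mul f) hθ'm hθ'G hM₁ hL1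
  refine ⟨hInt, ?_⟩
  have hAVG := integral_wt_smul_mul_conj_eq_mul_conj_borelConstantTerm_two hc hc1 νG ν h𝓕N h𝓕₀ h𝓕top hβ (ψ := fun g => f (borelHeight g : ℝ)) (Λ' := θ') hfm hθ'm
    (comp_borelHeight_unipotent_mul f) (comp_borelHeight_arithmeticBorel_mul f) (fun b _ x => hθ'G b x) (lintegral_weight_mul_conj_lt_top νG β hM₁ hL1)
  -- (5) the constant term of `θ′` is `F′∘H`
  have hCT : ∀ g : (quasiSplit (↥(maximalRealSubfield L)) L (IsCMField.complexConj L) 2).Adelic, borelConstantTerm ν 𝓕 θ' g = F' (borelHeight g : ℝ) := fun g => by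
    rw [hθ', borelConstantTerm_eisensteinSeriesU_comp_borelHeight_cm_two L ν h𝓕N h𝓕c h𝓕₀ hf' hf's hf'0 hσ₀ g]
  have hΨeq : ∫ g, (β g).toReal • (f (borelHeight g : ℝ) * conj (borelConstantTerm ν 𝓕 θ' g)) ∂νG = ∫ g, (β g).toReal • φ₀ (borelHeight g : ℝ) ∂νG :=
    integral_congr_ae (ae_of_all _ fun g => by simp only [hCT g, hφ₀])
  -- (6) to the idele classes (★ (δ)₂, Bochner): `Ψ = φ₀∘H`, `Φ = m_K·φ₀(‖·‖)`, `Φm = max(B,0)·‖f(‖·‖)‖`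
  have hΨm : Measurable fun g : (quasiSplit (↥(maximalRealSubfield L)) L (IsCMField.complexConj L) 2).Adelic => φ₀ (borelHeight g : ℝ) :=
    (hφ₀c.comp_continuous hHc fun g => (by exact_mod_cast borelHeight_pos g : (0 : ℝ) < borelHeight g)).measurable
  have hΦc : Continuous fun x : (AdeleRing (𝓞 L) L)ˣ => φ₀ (IdeleClassGroup.ideleNorm L x : ℝ) := hφ₀c.comp_continuous hIc fun x => ideleNorm_real_pos x
  have hfin : ∫⁻ x in 𝓕I, (((IdeleClassGroup.ideleNorm L x)⁻¹ : ℝ≥0) : ℝ≥0∞) * (‖f (IdeleClassGroup.ideleNorm L x : ℝ)‖ₑ * ENNReal.ofReal (max B 0)) ∂νI < ∞ := by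
    rw [setLIntegral_inv_ideleNorm_mul_comp_eq νI h𝓕I (Gm := fun r => ‖f r‖ₑ * ENNReal.ofReal (max B 0)) (hf.continuous.measurable.enorm.mul_const _)]
    exact ENNReal.mul_lt_top hVt.lt_top (setLIntegral_inv_mul_inv_mul_enorm_lt_top hf.continuous hfs hf0 ENNReal.ofReal_ne_top)
  obtain ⟨-, -, hδE⟩ := hδ β hβ (fun g => φ₀ (borelHeight g : ℝ)) hΨm
    (fun n y => by simp only [borelHeight_unipotent_mul ((mem_unipotentInBorel_iff _).1 n.2)])
    (fun b hb y => by simp only [K2E1TruncatedEisensteinExplicit.borelHeight_arithmeticBorel_mul hb])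
    (fun x => ((μK.real Set.univ : ℝ) : ℂ) * φ₀ (IdeleClassGroup.ideleNorm L x : ℝ)) (measurable_const.mul hΦc.measurable)
    (fun k hk x => by simp only [map_mul, ideleNorm_principal hk, one_mul]) (fun t => by simp_rw [hHtk t]; exact integral_maximalCompact_const μK _)
    (fun x => ‖f (IdeleClassGroup.ideleNorm L x : ℝ)‖ₑ * ENNReal.ofReal (max B 0)) ((hf.continuous.comp hIc).measurable.enorm.mul_const _)
    (fun k hk x => by simp only [map_mul, ideleNorm_principal hk, one_mul]) (fun t k => by rw [hHtk t k]; exact hφ₀le _) hfin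
  -- (7) Tate's `d𝔞 = d𝔟 dt∕t` (★ C): the idele class integral is a `dr∕r²` integral on `(0,∞)`
  have hC := setIntegral_inv_ideleNorm_smul_comp_eq νI h𝓕I (φ := fun r => ((μK.real Set.univ : ℝ) : ℂ) * φ₀ r)
    ((continuous_const.mul (hφ₀c.comp_continuous Real.continuous_exp fun u => Real.exp_pos u)).aestronglyMeasurable)
  -- (8) the two Parseval identities and their combination
  have hIA : IntegrableOn (fun r : ℝ => f r * conj (f' r) * (r : ℂ) ^ (-2 : ℂ)) (Ioi 0) := by
    have h := integrable_ofReal_cpow_mul (f := fun r => f r * conj (f' r)) (hf.continuous.mul (continuous_conj.comp hf'.continuous)) hfs.mul_right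
      ((tsupport_mul_subset_left (f := f) (g := fun r => conj (f' r))).trans hf0) (-2 : ℂ)
    exact (h.congr (ae_of_all _ fun r => by simp only; ring)).integrableOn
  obtain ⟨B₂, hB₂⟩ := hfs.isCompact.exists_bound_of_continuousOn (hMc.mono hf0)
  have hIB : IntegrableOn (fun r : ℝ => f r * (r : ℂ) ^ (-2 : ℂ) * conj (Mf' r)) (Ioi 0) := by
    have hmeas : AEStronglyMeasurable (fun r : ℝ => f r * (r : ℂ) ^ (-2 : ℂ) * conj (Mf' r)) (volume.restrict (Ioi 0)) := by
      refine ContinuousOn.aestronglyMeasurable ?_ measurableSet_Ioi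
      exact (hf.continuous.continuousOn.mul (fun r hr => (continuousAt_ofReal_cpow_const r (-2 : ℂ) (Or.inr (ne_of_gt hr))).continuousWithinAt)).mul
        (continuous_conj.comp_continuousOn hMc)
    refine Integrable.mono' (((integrable_ofReal_cpow_mul hf.continuous hfs hf0 (-2 : ℂ)).norm.mul_const (max B₂ 0)).integrableOn) hmeas (ae_of_all _ fun r => ?_)
    by_cases hr : f r = 0
    · simp [hr]
    · have hmem : r ∈ tsupport f := subset_tsupport f (Function.mem_support.2 hr)
      rw [norm_mul, norm_mul, norm_mul, Complex.norm_conj, mul_comm ‖f r‖]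
      exact mul_le_mul_of_nonneg_left ((hB₂ r hmem).trans (le_max_left _ _)) (mul_nonneg (norm_nonneg _) (norm_nonneg _))
  have hsplit : ∫ r in Ioi (0 : ℝ), (fun r : ℝ => ((μK.real Set.univ : ℝ) : ℂ) * φ₀ r) r * (r : ℂ) ^ (-2 : ℂ) =
      ((μK.real Set.univ : ℝ) : ℂ) * ((∫ r in Ioi (0 : ℝ), f r * conj (f' r) * (r : ℂ) ^ (-2 : ℂ)) + (κN : ℂ) * ∫ r in Ioi (0 : ℝ), f r * (r : ℂ) ^ (-2 : ℂ) * conj (Mf' r)) := by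
    rw [← integral_const_mul, ← integral_add hIA (hIB.const_mul _), ← integral_const_mul]
    refine setIntegral_congr_fun measurableSet_Ioi fun r _ => ?_
    simp only [hφ₀, hF', map_add, map_mul, conj_ofReal]
    ring
  have hPI := setIntegral_mul_conj_mul_cpow_eq hf hfs hf0 hf'.continuous hf's hf'0 σ₀
  have hPII : ∫ r in Ioi (0 : ℝ), f r * (r : ℂ) ^ (-2 : ℂ) * conj (Mf' r) =
      (((2 * π)⁻¹ : ℝ) : ℂ) * ∫ y : ℝ, mellin f (-((σ₀ : ℂ) + y * I)) * conj (mellin f' (-conj ((σ₀ : ℂ) + y * I))) * cfun ((σ₀ : ℂ) + y * I) := by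
    rw [hMf', setIntegral_mul_cpow_mul_conj_integral_eq hf.continuous hfs hf0 hf' hf's hf'0 σ₀ hcc hcb]
    refine congrArg _ (integral_congr_ae (ae_of_all _ fun y => ?_))
    dsimp only
    rw [hsym, conj_conj]
  -- vertical integrability of the two Parseval integrands (to merge them)
  obtain ⟨hGc, hGi⟩ := continuous_and_integrable_norm_mellin_neg hf hfs hf0 σ₀
  have hI1 : Integrable fun y : ℝ => mellin f (-((σ₀ : ℂ) + y * I)) * conj (mellin f' (conj ((σ₀ : ℂ) + y * I) - 1)) := by
    have hc1' : Continuous fun y : ℝ => mellin f' (conj ((σ₀ : ℂ) + y * I) - 1) := (differentiable_mellin hf'.continuous hf's hf'0).continuous.comp ((continuous_conj.comp (by fun_prop)).sub continuous_const)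
    refine Integrable.mono' (hGi.mul_const (∫ t in Ioi 0, t ^ (σ₀ - 1 - 1) * ‖f' t‖)) (hGc.mul (continuous_conj.comp hc1')).aestronglyMeasurable (ae_of_all _ fun y => ?_)
    rw [norm_mul, Complex.norm_conj]
    refine mul_le_mul_of_nonneg_left ?_ (norm_nonneg _)
    have h := norm_mellin_le f' (conj ((σ₀ : ℂ) + y * I) - 1)
    have hre : (conj ((σ₀ : ℂ) + y * I) - 1).re = σ₀ - 1 := by simp
    rwa [hre] at h
  have hI2 : Integrable fun y : ℝ => mellin f (-((σ₀ : ℂ) + y * I)) * conj (mellin f' (-conj ((σ₀ : ℂ) + y * I))) * cfun ((σ₀ : ℂ) + y * I) := by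
    have hc2' : Continuous fun y : ℝ => mellin f' (-conj ((σ₀ : ℂ) + y * I)) := (differentiable_mellin hf'.continuous hf's hf'0).continuous.comp (continuous_conj.comp (by fun_prop)).neg
    have hC₀ := hcb 0
    refine Integrable.mono' ((hGi.mul_const (∫ t in Ioi 0, t ^ (-σ₀ - 1) * ‖f' t‖)).mul_const C₀) (((hGc.mul (continuous_conj.comp hc2')).mul hcc).aestronglyMeasurable) (ae_of_all _ fun y => ?_)
    rw [norm_mul, norm_mul, Complex.norm_conj]
    refine mul_le_mul (mul_le_mul_of_nonneg_left ?_ (norm_nonneg _)) (hcb y) (norm_nonneg _) (mul_nonneg (norm_nonneg _) ?_)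
    · have h := norm_mellin_le f' (-conj ((σ₀ : ℂ) + y * I))
      have hre : (-conj ((σ₀ : ℂ) + y * I)).re = -σ₀ := by simp
      rwa [hre] at h
    · exact setIntegral_nonneg measurableSet_Ioi fun t ht => mul_nonneg (Real.rpow_nonneg ht.le _) (norm_nonneg _)
  have hcomb : (∫ y : ℝ, mellin f (-((σ₀ : ℂ) + y * I)) * conj (mellin f' (conj ((σ₀ : ℂ) + y * I) - 1))) + (κN : ℂ) * ∫ y : ℝ, mellin f (-((σ₀ : ℂ) + y * I)) * conj (mellin f' (-conj ((σ₀ : ℂ) + y * I))) * cfun ((σ₀ : ℂ) + y * I) =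
      ∫ y : ℝ, mellin f (-((σ₀ : ℂ) + y * I)) * (conj (mellin f' (conj ((σ₀ : ℂ) + y * I) - 1)) +
        (κN : ℂ) * (∫ v : ↥(adelicUnipotent (↥(maximalRealSubfield L)) L (IsCMField.complexConj L) 2), (((borelHeight ((quasiSplit (↥(maximalRealSubfield L)) L (IsCMField.complexConj L) 2).toAdelic (weylLongU ((IsCMField.complexConj L : L ≃ₐ[↥(maximalRealSubfield L)] L) : L →+* L) (rfl : (StdForm.antidiagonal 2).over L = (StdForm.antidiagonal 2).over L)) * (v : (quasiSplit (↥(maximalRealSubfield L)) L (IsCMField.complexConj L) 2).Adelic))) : ℝ) : ℂ) ^ (((σ₀ : ℂ) + y * I)) ∂ν) *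
          conj (mellin f' (-conj ((σ₀ : ℂ) + y * I)))) := by
    rw [← integral_const_mul, ← integral_add hI1 (hI2.const_mul _)]
    refine integral_congr_ae (ae_of_all _ fun y => ?_)
    simp only [hcfun]
    ring
  -- (9) assembly
  rw [hEq, hAVG, hΨeq, hδE, hC, Complex.real_smul, hsplit, hPI, hPII, ← hcomb]
  push_cast
  ring

end Head

end Summit.HodgeConjecture.HodgeConjecture.Cruxes.H413.K2E1PseudoEisensteinInnerProductCMTwoFinal

end
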